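import Mathlib.Analysis.SpecialFunctions.Exponential
import Mathlib.Analysis.Complex.Exponential
import Mathlib.Tactic.Module
import Literature.MathematicalPhysics.QuantumFieldTheory.Balaban1983to89.MatrixNorms
import Literature.MathematicalPhysics.QuantumFieldTheory.Balaban1983to89.B7TransferAnalyticMean
import HarnessLib

/-!
# Route `UnitScaleTilt`, crux K1 child «MinimiserStabilityRegPr» (stmt-QuantumFields-19200), leaf V2′ `stub_halvingStep` — pillar P3b
# ([Balaban1985Variational] PROP. 4 AT BACKGROUND 1), PART 1: **THE THIRD-ORDER EXPANSION OF THE FOUR-FACTOR PLAQUETTE PRODUCT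
# `e^{Y₁}e^{Y₂}e^{Y₃}e^{Y₄}` WITH A QUARTIC REMAINDER, AND THE ALGEBRA OF ITS CUBIC TERM** (Banach-algebra / matrix algebra only; no lattice)

Cell `ym3-torus` (HUMAN RULING D-0037, YM ladder rung R3), width seat `ym-ust-19200-w5` gen 0 (OWNER ym3-torus-plan g24, W-SEAT MAP pass #2
2026-08-28: «w5 = `stub_halvingStep` sub-lemma P3b = [Balaban1985Variational] Prop. 4 (98) pp. 292–293 at background 1 = the displayed `hWq`∕`hWd` of F4
`FlatSmallSolution158.existsUnique_smallSolution158_T3`»).  `--supports stmt-QuantumFields-19200 --as helper`; count-neutral.  YM₃ on T³ is a ladder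
rung (R3), not the Clay problem; nothing here is a claim about the crux, d = 4 or the mass gap.

THE PRINT.  [Balaban1985Variational] Sect. B expands the action `A(U₁U₀)`, `U₁ = e^{iηA}`, around a background: (22) `e^{iηA} = 1 + iηA + ½(iηA)² +
(1/3!)(iηA)³ + (iηA)⁴R₄(iηA)`, `|R_n(X)| ≤ e^{|X|}`; (26) `A(U₁U₀) = A(U₀) + ⟨A,J⟩ + ½⟨A,ΔA⟩ + V₀(A)`, «the expansion of V₀(A) begins with a third order
polynomial»; (29)–(31) `V₀ = V⁽³⁾ + V₄`, `|V₄(A,∂p)| ≤ (|A|(∂p))⁴e^{η|A|(∂p)}`; (34)–(36) the Baker–Campbell–Hausdorff form of the third-order term.  Prop. 4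
(pp. 292–293) then bounds the functional derivative of the non-quadratic part `V` on the space (97): «|(δ/δA′)V(A′)|₍₋₃₎ ≤ C₄(max{|A′|₍₋₁₎, |∇A′|₍₋₂₎})²
(98) … The constants a₃, C₄ depend on d and L only».  At background `1` (Sect. F p. 302 «all the operators in this section are taken without any external
gauge field configuration») the plaquette of `U₁ = e^{iηA}` is the four-factor product `e^{Y₁}e^{Y₂}e^{Y₃}e^{Y₄}`, `Y₁ = iηA(b₁)`, `Y₂ = iηA(b₂)`, `Y₃ = −iηA(b₃)`,
`Y₄ = −iηA(b₄)`.  THIS FILE is the lattice-free EXPANSION of that product which the gradient estimate (98) rests on (the companion `…FlatPlaqCubicGradient` has the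
cubic term's algebra; later parts supply the lattice combinatorics and the estimate itself in F4's letters):
* §1 `norm_exp_sub_partialSum_le` — in a complete normed `ℂ`-algebra with `‖1‖ = 1`: `‖e^x − Σ_{m<n} xᵐ/m!‖ ≤ e^{‖x‖} − Σ_{m<n} ‖x‖ᵐ/m!`, and for
  `‖x‖ ≤ 1` the numerical forms `‖e^x − 1 − x‖ ≤ ¾‖x‖²`, `‖e^x − 1 − x − ½x²‖ ≤ (2/9)‖x‖³`, `‖e^x − 1 − x − ½x² − ⅙x³‖ ≤ (5/96)‖x‖⁴` (Mathlib
  `Real.exp_bound` transported termwise; `‖e^x − 1‖ ≤ 2‖x‖` is the tree's `B7TransferAnalyticMean.norm_exp_sub_one_le_two_mul`).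
* §2 **`norm_exp4_sub_taylor3_le`** — for `‖Yᵢ‖ ≤ m ≤ 1`: `‖e^{Y₁}e^{Y₂}e^{Y₃}e^{Y₄} − (1 + ΣYᵢ + Q(Y) + C(Y))‖ ≤ 44·m⁴` with the ORDERED second and
  third Taylor terms `Q(Y) = ½ΣYᵢ² + Σ_{i<j}YᵢYⱼ`, `C(Y) = ⅙ΣYᵢ³ + ½Σ_{i<j}(Yᵢ²Yⱼ + YᵢYⱼ²) + Σ_{i<j<k}YᵢYⱼY_k` — (22)∕(34)–(36) with a CRUDE absolute constant.
* (the cubic term's trace-gradient algebra — slot-one derivative, cyclic invariance, the Leibniz cancellation identity — is the companion file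
  `UnitScaleTiltProp8FlatPlaqCubicGradient`.)
HONEST SCOPE.  Elementary ([folklore]) Banach-algebra and matrix identities, cited to the printed step they serve; nothing of Bałaban's is asserted; the
constant `44` is crude (print's (33) has `25`).  Sorry-free, no definition, axioms standard.

References: T. Bałaban, CMP **102** (1985) 277–309 [Balaban1985Variational] (22)–(36) pp.281–283, Prop. 4 (97)–(98) pp.292–293, Sect. F p.302.
-/

set_option autoImplicit false

noncomputable section

open scoped BigOperators
open NormedSpace Finset
open Literature.MathematicalPhysics.QuantumFieldTheory.Balaban1983to89

namespace Summit.QuantumFields.YangMills.Theorems.FlatPlaqCubic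

/-! ## §1 Taylor remainders of the exponential in a Banach algebra -/

section ExpRemainder

variable {𝔄 : Type*} [NormedRing 𝔄] [NormedAlgebra ℂ 𝔄] [CompleteSpace 𝔄] [NormOneClass 𝔄]

/-- **Termwise domination of the exponential tail**: `‖e^x − Σ_{m<n} xᵐ/m!‖ ≤ e^{‖x‖} − Σ_{m<n} ‖x‖ᵐ/m!` (every `n`; `n = 0` reads `‖e^x‖ ≤ e^{‖x‖}`).
[folklore] -/
theorem norm_exp_sub_partialSum_le (x : 𝔄) (n : ℕ) :
    ‖exp x - ∑ m ∈ range n, ((m.factorial : ℂ)⁻¹) • x ^ m‖ ≤ Real.exp ‖x‖ - ∑ m ∈ range n, ‖x‖ ^ m / m.factorial := by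
  have h1 : HasSum (fun k ↦ ((k.factorial : ℂ)⁻¹) • x ^ k) (exp x) := exp_series_hasSum_exp' (𝕂 := ℂ) x
  have h2 : HasSum (fun k : ℕ ↦ (((k + n).factorial : ℂ)⁻¹) • x ^ (k + n))
      (exp x - ∑ m ∈ range n, ((m.factorial : ℂ)⁻¹) • x ^ m) := (hasSum_nat_add_iff' n).2 h1
  have h1' : HasSum (fun k ↦ ((k.factorial : ℝ)⁻¹) • ‖x‖ ^ k) (Real.exp ‖x‖) := by
    rw [Real.exp_eq_exp_ℝ]
    exact exp_series_hasSum_exp' (𝕂 := ℝ) ‖x‖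
  have h3 : HasSum (fun k : ℕ ↦ (((k + n).factorial : ℝ)⁻¹) • ‖x‖ ^ (k + n))
      (Real.exp ‖x‖ - ∑ m ∈ range n, ((m.factorial : ℝ)⁻¹) • ‖x‖ ^ m) := (hasSum_nat_add_iff' n).2 h1'
  have hre : ∑ m ∈ range n, ((m.factorial : ℝ)⁻¹) • ‖x‖ ^ m = ∑ m ∈ range n, ‖x‖ ^ m / m.factorial := by
    refine sum_congr rfl fun m _ => ?_
    rw [smul_eq_mul, div_eq_inv_mul]
  rw [hre] at h3
  have h4 : ∀ k : ℕ, ‖(((k + n).factorial : ℂ)⁻¹) • x ^ (k + n)‖ ≤ (((k + n).factorial : ℝ)⁻¹) • ‖x‖ ^ (k + n) := by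
    intro k
    rw [norm_smul, norm_inv, Complex.norm_natCast, smul_eq_mul]
    exact mul_le_mul_of_nonneg_left (norm_pow_le _ _) (by positivity)
  exact h2.norm_le_of_bounded h3 h4

/-- The real numerics behind the four remainder bounds: for `0 ≤ s ≤ 1` and `0 < n`,
`e^s − Σ_{m<n} sᵐ/m! ≤ sⁿ·(n+1)/(n!·n)` (Mathlib `Real.exp_bound`). [folklore] -/
theorem rexp_sub_partialSum_le {s : ℝ} (hs0 : 0 ≤ s) (hs : s ≤ 1) {n : ℕ} (hn : 0 < n) :
    Real.exp s - ∑ m ∈ range n, s ^ m / m.factorial ≤ s ^ n * ((n.succ : ℝ) / (n.factorial * n)) := by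
  have h := Real.exp_bound (x := s) (by rwa [abs_of_nonneg hs0]) hn
  rw [abs_of_nonneg hs0] at h
  exact (le_abs_self _).trans h

/-- `‖e^x − 1 − x‖ ≤ ¾‖x‖²` for `‖x‖ ≤ 1`. [cite: Balaban1985Variational, (22)-(23) p.281] -/
theorem norm_exp_sub_two_le {x : 𝔄} (hx : ‖x‖ ≤ 1) : ‖exp x - 1 - x‖ ≤ 3 / 4 * ‖x‖ ^ 2 := by
  have h := norm_exp_sub_partialSum_le x 2
  have hr := rexp_sub_partialSum_le (norm_nonneg x) hx (by norm_num : 0 < 2)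
  norm_num [Nat.factorial, sum_range_succ] at h hr
  have e1 : exp x - (1 + x) = exp x - 1 - x := by abel
  rw [e1] at h
  linarith

/-- `‖e^x − 1 − x − ½x²‖ ≤ (2/9)‖x‖³` for `‖x‖ ≤ 1`. [cite: Balaban1985Variational, (22)-(23) p.281] -/
theorem norm_exp_sub_three_le {x : 𝔄} (hx : ‖x‖ ≤ 1) :
    ‖exp x - 1 - x - (2 : ℂ)⁻¹ • x ^ 2‖ ≤ 2 / 9 * ‖x‖ ^ 3 := by
  have h := norm_exp_sub_partialSum_le x 3
  have hr := rexp_sub_partialSum_le (norm_nonneg x) hx (by norm_num : 0 < 3)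
  norm_num [Nat.factorial, sum_range_succ] at h hr
  have e1 : exp x - (1 + x + (1 / 2 : ℂ) • x ^ 2) = exp x - 1 - x - (2 : ℂ)⁻¹ • x ^ 2 := by
    rw [one_div]; abel
  rw [e1] at h
  linarith

/-- `‖e^x − 1 − x − ½x² − ⅙x³‖ ≤ (5/96)‖x‖⁴` for `‖x‖ ≤ 1` — the remainder `(iηA)⁴R₄` of (22). [cite: Balaban1985Variational, (22)-(23) p.281] -/
theorem norm_exp_sub_four_le {x : 𝔄} (hx : ‖x‖ ≤ 1) :
    ‖exp x - 1 - x - (2 : ℂ)⁻¹ • x ^ 2 - (6 : ℂ)⁻¹ • x ^ 3‖ ≤ 5 / 96 * ‖x‖ ^ 4 := by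
  have h := norm_exp_sub_partialSum_le x 4
  have hr := rexp_sub_partialSum_le (norm_nonneg x) hx (by norm_num : 0 < 4)
  norm_num [Nat.factorial, sum_range_succ] at h hr
  have e1 : exp x - (1 + x + (1 / 2 : ℂ) • x ^ 2 + (1 / 6 : ℂ) • x ^ 3) =
      exp x - 1 - x - (2 : ℂ)⁻¹ • x ^ 2 - (6 : ℂ)⁻¹ • x ^ 3 := by
    rw [one_div, one_div]; abel
  rw [e1] at h
  linarith

end ExpRemainder

/-! ## §2 The four-factor product `e^{Y₁}e^{Y₂}e^{Y₃}e^{Y₄}` to third order -/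

section Product

variable {𝔄 : Type*} [NormedRing 𝔄] [NormedAlgebra ℂ 𝔄] [CompleteSpace 𝔄] [NormOneClass 𝔄]

omit [NormedAlgebra ℂ 𝔄] [CompleteSpace 𝔄] in
/-- `‖n·X‖ ≤ n‖X‖` for a numeral `n` in a normed algebra with `‖1‖ = 1`. [folklore] -/
theorem norm_natCast_mul_le (n : ℕ) (X : 𝔄) : ‖(n : 𝔄) * X‖ ≤ n * ‖X‖ :=
  (norm_mul_le _ _).trans (mul_le_mul_of_nonneg_right ((Nat.norm_cast_le n).trans (by rw [norm_one, mul_one])) (norm_nonneg _))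

/-- The single-factor pieces: for `‖Y‖ ≤ m ≤ 1`, with `u = e^Y − 1`, `v = e^Y − 1 − Y`, `2w = 2v − Y²`, `6R = 6v − 3Y² − Y³`:
`‖u‖ ≤ 2m`, `‖v‖ ≤ ¾m²`, `‖2w‖ ≤ (4/9)m³`, `‖6R‖ ≤ (5/16)m⁴`. [cite: Balaban1985Variational, (22)-(23) p.281] -/
theorem single_pieces {Y : 𝔄} {m : ℝ} (hY : ‖Y‖ ≤ m) (hm : m ≤ 1) :
    ‖exp Y - 1‖ ≤ 2 * m ∧ ‖exp Y - 1 - Y‖ ≤ 3 / 4 * m ^ 2 ∧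
      ‖2 * (exp Y - 1 - Y) - Y ^ 2‖ ≤ 4 / 9 * m ^ 3 ∧ ‖6 * (exp Y - 1 - Y) - 3 * Y ^ 2 - Y ^ 3‖ ≤ 5 / 16 * m ^ 4 := by
  have h0 : 0 ≤ ‖Y‖ := norm_nonneg _
  have hY1 : ‖Y‖ ≤ 1 := hY.trans hm
  have hp2 : ‖Y‖ ^ 2 ≤ m ^ 2 := pow_le_pow_left₀ h0 hY 2
  have hp3 : ‖Y‖ ^ 3 ≤ m ^ 3 := pow_le_pow_left₀ h0 hY 3
  have hp4 : ‖Y‖ ^ 4 ≤ m ^ 4 := pow_le_pow_left₀ h0 hY 4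
  refine ⟨(B7TransferAnalyticMean.norm_exp_sub_one_le_two_mul hY1).trans (by linarith), (norm_exp_sub_two_le hY1).trans (by linarith), ?_, ?_⟩
  · have e2 : 2 * (exp Y - 1 - Y) - Y ^ 2 = (2 : ℂ) • (exp Y - 1 - Y - (2 : ℂ)⁻¹ • Y ^ 2) := by
      rw [smul_sub, smul_smul, mul_inv_cancel₀ (two_ne_zero), one_smul, Algebra.smul_def, map_ofNat]
    rw [e2, norm_smul, Complex.norm_ofNat]
    have := norm_exp_sub_three_le hY1
    nlinarith
  · have e6 : 6 * (exp Y - 1 - Y) - 3 * Y ^ 2 - Y ^ 3 =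
        (6 : ℂ) • (exp Y - 1 - Y - (2 : ℂ)⁻¹ • Y ^ 2 - (6 : ℂ)⁻¹ • Y ^ 3) := by
      rw [smul_sub, smul_sub, smul_smul, smul_smul, mul_inv_cancel₀ (by norm_num : (6 : ℂ) ≠ 0), one_smul,
        show (6 : ℂ) * (2 : ℂ)⁻¹ = 3 by norm_num, Algebra.smul_def, Algebra.smul_def, map_ofNat, map_ofNat]
    rw [e6, norm_smul, Complex.norm_ofNat]
    have := norm_exp_sub_four_le hY1
    nlinarith

omit [NormedAlgebra ℂ 𝔄] [CompleteSpace 𝔄] in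
/-- The pair term of the expansion: `‖3(Yᵢ·2wⱼ + 2wᵢ·Yⱼ) + 6vᵢvⱼ‖ ≤ (145/24)m⁴`. [folklore] -/
theorem pair_piece_le {Yi Yj wi wj vi vj : 𝔄} {m : ℝ} (hm0 : 0 ≤ m) (hYi : ‖Yi‖ ≤ m) (hYj : ‖Yj‖ ≤ m)
    (hwi : ‖wi‖ ≤ 4 / 9 * m ^ 3) (hwj : ‖wj‖ ≤ 4 / 9 * m ^ 3) (hvi : ‖vi‖ ≤ 3 / 4 * m ^ 2) (hvj : ‖vj‖ ≤ 3 / 4 * m ^ 2) :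
    ‖3 * (Yi * wj + wi * Yj) + 6 * (vi * vj)‖ ≤ 145 / 24 * m ^ 4 := by
  have h1 : ‖Yi * wj‖ ≤ m * (4 / 9 * m ^ 3) := (norm_mul_le _ _).trans (mul_le_mul hYi hwj (norm_nonneg _) hm0)
  have h2 : ‖wi * Yj‖ ≤ 4 / 9 * m ^ 3 * m := (norm_mul_le _ _).trans (mul_le_mul hwi hYj (norm_nonneg _) (by positivity))
  have h3 : ‖vi * vj‖ ≤ 3 / 4 * m ^ 2 * (3 / 4 * m ^ 2) :=
    (norm_mul_le _ _).trans (mul_le_mul hvi hvj (norm_nonneg _) (by positivity))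
  have h4 : ‖(3 : 𝔄) * (Yi * wj + wi * Yj)‖ ≤ 3 * (m * (4 / 9 * m ^ 3) + 4 / 9 * m ^ 3 * m) :=
    (norm_natCast_mul_le 3 _).trans (by push_cast; exact mul_le_mul_of_nonneg_left ((norm_add_le _ _).trans (add_le_add h1 h2)) (by norm_num))
  have h5 : ‖(6 : 𝔄) * (vi * vj)‖ ≤ 6 * (3 / 4 * m ^ 2 * (3 / 4 * m ^ 2)) :=
    (norm_natCast_mul_le 6 _).trans (by push_cast; exact mul_le_mul_of_nonneg_left h3 (by norm_num))
  calc ‖3 * (Yi * wj + wi * Yj) + 6 * (vi * vj)‖ ≤ ‖(3 : 𝔄) * (Yi * wj + wi * Yj)‖ + ‖(6 : 𝔄) * (vi * vj)‖ := norm_add_le _ _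
    _ ≤ 145 / 24 * m ^ 4 := by nlinarith [h4, h5]

omit [NormedAlgebra ℂ 𝔄] [CompleteSpace 𝔄] in
/-- The triple term: `‖6(vᵢuⱼu_k + Yᵢvⱼu_k + YᵢYⱼv_k)‖ ≤ (63/2)m⁴`. [folklore] -/
theorem triple_piece_le {Yi Yj vi vj vk uj uk : 𝔄} {m : ℝ} (hm0 : 0 ≤ m) (hYi : ‖Yi‖ ≤ m) (hYj : ‖Yj‖ ≤ m)
    (hvi : ‖vi‖ ≤ 3 / 4 * m ^ 2) (hvj : ‖vj‖ ≤ 3 / 4 * m ^ 2) (hvk : ‖vk‖ ≤ 3 / 4 * m ^ 2)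
    (huj : ‖uj‖ ≤ 2 * m) (huk : ‖uk‖ ≤ 2 * m) :
    ‖6 * (vi * uj * uk + Yi * vj * uk + Yi * Yj * vk)‖ ≤ 63 / 2 * m ^ 4 := by
  have h1 : ‖vi * uj * uk‖ ≤ 3 / 4 * m ^ 2 * (2 * m) * (2 * m) :=
    (norm_mul_le _ _).trans (mul_le_mul ((norm_mul_le _ _).trans (mul_le_mul hvi huj (norm_nonneg _) (by positivity)))
      huk (norm_nonneg _) (by positivity))
  have h2 : ‖Yi * vj * uk‖ ≤ m * (3 / 4 * m ^ 2) * (2 * m) :=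
    (norm_mul_le _ _).trans (mul_le_mul ((norm_mul_le _ _).trans (mul_le_mul hYi hvj (norm_nonneg _) hm0))
      huk (norm_nonneg _) (by positivity))
  have h3 : ‖Yi * Yj * vk‖ ≤ m * m * (3 / 4 * m ^ 2) :=
    (norm_mul_le _ _).trans (mul_le_mul ((norm_mul_le _ _).trans (mul_le_mul hYi hYj (norm_nonneg _) hm0))
      hvk (norm_nonneg _) (by positivity))
  have h4 : ‖vi * uj * uk + Yi * vj * uk + Yi * Yj * vk‖ ≤
      3 / 4 * m ^ 2 * (2 * m) * (2 * m) + m * (3 / 4 * m ^ 2) * (2 * m) + m * m * (3 / 4 * m ^ 2) :=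
    (norm_add_le _ _).trans (add_le_add ((norm_add_le _ _).trans (add_le_add h1 h2)) h3)
  calc ‖6 * (vi * uj * uk + Yi * vj * uk + Yi * Yj * vk)‖
      ≤ 6 * ‖vi * uj * uk + Yi * vj * uk + Yi * Yj * vk‖ := by exact_mod_cast norm_natCast_mul_le 6 _
    _ ≤ 63 / 2 * m ^ 4 := by nlinarith [h4]

omit [NormedAlgebra ℂ 𝔄] [CompleteSpace 𝔄] in
/-- The quadruple term: `‖6u₁u₂u₃u₄‖ ≤ 96m⁴`. [folklore] -/
theorem quad_piece_le {u1 u2 u3 u4 : 𝔄} {m : ℝ} (hm0 : 0 ≤ m) (h1 : ‖u1‖ ≤ 2 * m) (h2 : ‖u2‖ ≤ 2 * m) (h3 : ‖u3‖ ≤ 2 * m)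
    (h4 : ‖u4‖ ≤ 2 * m) : ‖6 * (u1 * u2 * u3 * u4)‖ ≤ 96 * m ^ 4 := by
  have h12 : ‖u1 * u2‖ ≤ 2 * m * (2 * m) := (norm_mul_le _ _).trans (mul_le_mul h1 h2 (norm_nonneg _) (by positivity))
  have h123 : ‖u1 * u2 * u3‖ ≤ 2 * m * (2 * m) * (2 * m) :=
    (norm_mul_le _ _).trans (mul_le_mul h12 h3 (norm_nonneg _) (by positivity))
  have h1234 : ‖u1 * u2 * u3 * u4‖ ≤ 2 * m * (2 * m) * (2 * m) * (2 * m) :=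
    (norm_mul_le _ _).trans (mul_le_mul h123 h4 (norm_nonneg _) (by positivity))
  calc ‖6 * (u1 * u2 * u3 * u4)‖ ≤ 6 * ‖u1 * u2 * u3 * u4‖ := by exact_mod_cast norm_natCast_mul_le 6 _
    _ ≤ 96 * m ^ 4 := by nlinarith [h1234]

omit [CompleteSpace 𝔄] [NormOneClass 𝔄] in
/-- The regrouping identity behind `norm_exp4_sub_taylor3_le`: six times «product minus third-order Taylor polynomial» as an integer polynomial in
`eᵢ` and `Yᵢ`, collected into single ∕ pair ∕ triple ∕ quadruple pieces (`uᵢ = eᵢ − 1`, `vᵢ = eᵢ − 1 − Yᵢ`, `2wᵢ = 2vᵢ − Yᵢ²`, `6Rᵢ = 6vᵢ − 3Yᵢ² − Yᵢ³`).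
[folklore] -/
theorem six_smul_exp4_sub_taylor3_eq (e₁ e₂ e₃ e₄ Y₁ Y₂ Y₃ Y₄ : 𝔄) :
    (6 : ℂ) • (e₁ * e₂ * e₃ * e₄ -
      (1 + (Y₁ + Y₂ + Y₃ + Y₄) +
        ((2 : ℂ)⁻¹ • (Y₁ ^ 2 + Y₂ ^ 2 + Y₃ ^ 2 + Y₄ ^ 2) + (Y₁ * Y₂ + Y₁ * Y₃ + Y₁ * Y₄ + Y₂ * Y₃ + Y₂ * Y₄ + Y₃ * Y₄)) +
        ((6 : ℂ)⁻¹ • (Y₁ ^ 3 + Y₂ ^ 3 + Y₃ ^ 3 + Y₄ ^ 3) +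
          (2 : ℂ)⁻¹ • (Y₁ ^ 2 * Y₂ + Y₁ * Y₂ ^ 2 + Y₁ ^ 2 * Y₃ + Y₁ * Y₃ ^ 2 + Y₁ ^ 2 * Y₄ + Y₁ * Y₄ ^ 2 +
            Y₂ ^ 2 * Y₃ + Y₂ * Y₃ ^ 2 + Y₂ ^ 2 * Y₄ + Y₂ * Y₄ ^ 2 + Y₃ ^ 2 * Y₄ + Y₃ * Y₄ ^ 2) +
          (Y₁ * Y₂ * Y₃ + Y₁ * Y₂ * Y₄ + Y₁ * Y₃ * Y₄ + Y₂ * Y₃ * Y₄)))) =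
      ((6 * (e₁ - 1 - Y₁) - 3 * Y₁ ^ 2 - Y₁ ^ 3) + (6 * (e₂ - 1 - Y₂) - 3 * Y₂ ^ 2 - Y₂ ^ 3)
        + (6 * (e₃ - 1 - Y₃) - 3 * Y₃ ^ 2 - Y₃ ^ 3) + (6 * (e₄ - 1 - Y₄) - 3 * Y₄ ^ 2 - Y₄ ^ 3))
      + ((3 * (Y₁ * (2 * (e₂ - 1 - Y₂) - Y₂ ^ 2) + (2 * (e₁ - 1 - Y₁) - Y₁ ^ 2) * Y₂) + 6 * ((e₁ - 1 - Y₁) * (e₂ - 1 - Y₂)))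
        + (3 * (Y₁ * (2 * (e₃ - 1 - Y₃) - Y₃ ^ 2) + (2 * (e₁ - 1 - Y₁) - Y₁ ^ 2) * Y₃) + 6 * ((e₁ - 1 - Y₁) * (e₃ - 1 - Y₃)))
        + (3 * (Y₁ * (2 * (e₄ - 1 - Y₄) - Y₄ ^ 2) + (2 * (e₁ - 1 - Y₁) - Y₁ ^ 2) * Y₄) + 6 * ((e₁ - 1 - Y₁) * (e₄ - 1 - Y₄)))
        + (3 * (Y₂ * (2 * (e₃ - 1 - Y₃) - Y₃ ^ 2) + (2 * (e₂ - 1 - Y₂) - Y₂ ^ 2) * Y₃) + 6 * ((e₂ - 1 - Y₂) * (e₃ - 1 - Y₃)))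
        + (3 * (Y₂ * (2 * (e₄ - 1 - Y₄) - Y₄ ^ 2) + (2 * (e₂ - 1 - Y₂) - Y₂ ^ 2) * Y₄) + 6 * ((e₂ - 1 - Y₂) * (e₄ - 1 - Y₄)))
        + (3 * (Y₃ * (2 * (e₄ - 1 - Y₄) - Y₄ ^ 2) + (2 * (e₃ - 1 - Y₃) - Y₃ ^ 2) * Y₄) + 6 * ((e₃ - 1 - Y₃) * (e₄ - 1 - Y₄))))
      + (6 * ((e₁ - 1 - Y₁) * (e₂ - 1) * (e₃ - 1) + Y₁ * (e₂ - 1 - Y₂) * (e₃ - 1) + Y₁ * Y₂ * (e₃ - 1 - Y₃))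
        + 6 * ((e₁ - 1 - Y₁) * (e₂ - 1) * (e₄ - 1) + Y₁ * (e₂ - 1 - Y₂) * (e₄ - 1) + Y₁ * Y₂ * (e₄ - 1 - Y₄))
        + 6 * ((e₁ - 1 - Y₁) * (e₃ - 1) * (e₄ - 1) + Y₁ * (e₃ - 1 - Y₃) * (e₄ - 1) + Y₁ * Y₃ * (e₄ - 1 - Y₄))
        + 6 * ((e₂ - 1 - Y₂) * (e₃ - 1) * (e₄ - 1) + Y₂ * (e₃ - 1 - Y₃) * (e₄ - 1) + Y₂ * Y₃ * (e₄ - 1 - Y₄)))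
      + 6 * ((e₁ - 1) * (e₂ - 1) * (e₃ - 1) * (e₄ - 1)) := by
  have lhs : (6 : ℂ) • (e₁ * e₂ * e₃ * e₄ -
      (1 + (Y₁ + Y₂ + Y₃ + Y₄) +
        ((2 : ℂ)⁻¹ • (Y₁ ^ 2 + Y₂ ^ 2 + Y₃ ^ 2 + Y₄ ^ 2) + (Y₁ * Y₂ + Y₁ * Y₃ + Y₁ * Y₄ + Y₂ * Y₃ + Y₂ * Y₄ + Y₃ * Y₄)) +
        ((6 : ℂ)⁻¹ • (Y₁ ^ 3 + Y₂ ^ 3 + Y₃ ^ 3 + Y₄ ^ 3) +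
          (2 : ℂ)⁻¹ • (Y₁ ^ 2 * Y₂ + Y₁ * Y₂ ^ 2 + Y₁ ^ 2 * Y₃ + Y₁ * Y₃ ^ 2 + Y₁ ^ 2 * Y₄ + Y₁ * Y₄ ^ 2 +
            Y₂ ^ 2 * Y₃ + Y₂ * Y₃ ^ 2 + Y₂ ^ 2 * Y₄ + Y₂ * Y₄ ^ 2 + Y₃ ^ 2 * Y₄ + Y₃ * Y₄ ^ 2) +
          (Y₁ * Y₂ * Y₃ + Y₁ * Y₂ * Y₄ + Y₁ * Y₃ * Y₄ + Y₂ * Y₃ * Y₄)))) =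
      6 * (e₁ * e₂ * e₃ * e₄) - 6 * 1 - 6 * (Y₁ + Y₂ + Y₃ + Y₄) - 3 * (Y₁ ^ 2 + Y₂ ^ 2 + Y₃ ^ 2 + Y₄ ^ 2)
      - 6 * (Y₁ * Y₂ + Y₁ * Y₃ + Y₁ * Y₄ + Y₂ * Y₃ + Y₂ * Y₄ + Y₃ * Y₄) - (Y₁ ^ 3 + Y₂ ^ 3 + Y₃ ^ 3 + Y₄ ^ 3)
      - 3 * (Y₁ ^ 2 * Y₂ + Y₁ * Y₂ ^ 2 + Y₁ ^ 2 * Y₃ + Y₁ * Y₃ ^ 2 + Y₁ ^ 2 * Y₄ + Y₁ * Y₄ ^ 2 +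
            Y₂ ^ 2 * Y₃ + Y₂ * Y₃ ^ 2 + Y₂ ^ 2 * Y₄ + Y₂ * Y₄ ^ 2 + Y₃ ^ 2 * Y₄ + Y₃ * Y₄ ^ 2)
      - 6 * (Y₁ * Y₂ * Y₃ + Y₁ * Y₂ * Y₄ + Y₁ * Y₃ * Y₄ + Y₂ * Y₃ * Y₄) := by
    simp only [smul_sub, smul_add, smul_smul]
    rw [show (6 : ℂ) * (2 : ℂ)⁻¹ = 3 by norm_num, show (6 : ℂ) * (6 : ℂ)⁻¹ = 1 by norm_num]
    rw [show (6 : ℂ) = ((6 : ℕ) : ℂ) by norm_num, show (3 : ℂ) = ((3 : ℕ) : ℂ) by norm_num]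
    simp only [Nat.cast_smul_eq_nsmul, one_smul]
    noncomm_ring
  rw [lhs]
  noncomm_ring

/-- **THE THIRD-ORDER EXPANSION OF THE FOUR-FACTOR PLAQUETTE PRODUCT WITH A QUARTIC REMAINDER** ((22), (34)–(36) at background 1, crude constant):
for `‖Yᵢ‖ ≤ m ≤ 1`,
`‖e^{Y₁}e^{Y₂}e^{Y₃}e^{Y₄} − (1 + ΣYᵢ + [½ΣYᵢ² + Σ_{i<j}YᵢYⱼ] + [⅙ΣYᵢ³ + ½Σ_{i<j}(Yᵢ²Yⱼ + YᵢYⱼ²) + Σ_{i<j<k}YᵢYⱼY_k])‖ ≤ 44·m⁴`.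
[cite: Balaban1985Variational, (22)-(26) pp.281-282, (34)-(36) p.283] -/
theorem norm_exp4_sub_taylor3_le (Y₁ Y₂ Y₃ Y₄ : 𝔄) {m : ℝ} (h1 : ‖Y₁‖ ≤ m) (h2 : ‖Y₂‖ ≤ m) (h3 : ‖Y₃‖ ≤ m) (h4 : ‖Y₄‖ ≤ m)
    (hm : m ≤ 1) :
    ‖exp Y₁ * exp Y₂ * exp Y₃ * exp Y₄ -
      (1 + (Y₁ + Y₂ + Y₃ + Y₄) +
        ((2 : ℂ)⁻¹ • (Y₁ ^ 2 + Y₂ ^ 2 + Y₃ ^ 2 + Y₄ ^ 2) + (Y₁ * Y₂ + Y₁ * Y₃ + Y₁ * Y₄ + Y₂ * Y₃ + Y₂ * Y₄ + Y₃ * Y₄)) +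
        ((6 : ℂ)⁻¹ • (Y₁ ^ 3 + Y₂ ^ 3 + Y₃ ^ 3 + Y₄ ^ 3) +
          (2 : ℂ)⁻¹ • (Y₁ ^ 2 * Y₂ + Y₁ * Y₂ ^ 2 + Y₁ ^ 2 * Y₃ + Y₁ * Y₃ ^ 2 + Y₁ ^ 2 * Y₄ + Y₁ * Y₄ ^ 2 +
            Y₂ ^ 2 * Y₃ + Y₂ * Y₃ ^ 2 + Y₂ ^ 2 * Y₄ + Y₂ * Y₄ ^ 2 + Y₃ ^ 2 * Y₄ + Y₃ * Y₄ ^ 2) +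
          (Y₁ * Y₂ * Y₃ + Y₁ * Y₂ * Y₄ + Y₁ * Y₃ * Y₄ + Y₂ * Y₃ * Y₄)))‖ ≤ 44 * m ^ 4 := by
  have hm0 : 0 ≤ m := (norm_nonneg _).trans h1
  obtain ⟨hu1, hv1, hw1, hr1⟩ := single_pieces h1 hm
  obtain ⟨hu2, hv2, hw2, hr2⟩ := single_pieces h2 hm
  obtain ⟨hu3, hv3, hw3, hr3⟩ := single_pieces h3 hm
  obtain ⟨hu4, hv4, hw4, hr4⟩ := single_pieces h4 hm
  -- six times the difference, as an integer polynomial in the `exp Yᵢ`, `Yᵢ`, regrouped into the pieces of `single_pieces`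
  have key := six_smul_exp4_sub_taylor3_eq (exp Y₁) (exp Y₂) (exp Y₃) (exp Y₄) Y₁ Y₂ Y₃ Y₄
  -- bounds of the four groups
  have hS : ‖(6 * (exp Y₁ - 1 - Y₁) - 3 * Y₁ ^ 2 - Y₁ ^ 3) + (6 * (exp Y₂ - 1 - Y₂) - 3 * Y₂ ^ 2 - Y₂ ^ 3)
        + (6 * (exp Y₃ - 1 - Y₃) - 3 * Y₃ ^ 2 - Y₃ ^ 3) + (6 * (exp Y₄ - 1 - Y₄) - 3 * Y₄ ^ 2 - Y₄ ^ 3)‖ ≤ 4 * (5 / 16 * m ^ 4) :=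
    ((norm_add_le _ _).trans (add_le_add ((norm_add_le _ _).trans (add_le_add ((norm_add_le _ _).trans (add_le_add hr1 hr2)) hr3))
      hr4)).trans (by linarith)
  have hP : ‖(3 * (Y₁ * (2 * (exp Y₂ - 1 - Y₂) - Y₂ ^ 2) + (2 * (exp Y₁ - 1 - Y₁) - Y₁ ^ 2) * Y₂) + 6 * ((exp Y₁ - 1 - Y₁) * (exp Y₂ - 1 - Y₂)))
        + (3 * (Y₁ * (2 * (exp Y₃ - 1 - Y₃) - Y₃ ^ 2) + (2 * (exp Y₁ - 1 - Y₁) - Y₁ ^ 2) * Y₃) + 6 * ((exp Y₁ - 1 - Y₁) * (exp Y₃ - 1 - Y₃)))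
        + (3 * (Y₁ * (2 * (exp Y₄ - 1 - Y₄) - Y₄ ^ 2) + (2 * (exp Y₁ - 1 - Y₁) - Y₁ ^ 2) * Y₄) + 6 * ((exp Y₁ - 1 - Y₁) * (exp Y₄ - 1 - Y₄)))
        + (3 * (Y₂ * (2 * (exp Y₃ - 1 - Y₃) - Y₃ ^ 2) + (2 * (exp Y₂ - 1 - Y₂) - Y₂ ^ 2) * Y₃) + 6 * ((exp Y₂ - 1 - Y₂) * (exp Y₃ - 1 - Y₃)))
        + (3 * (Y₂ * (2 * (exp Y₄ - 1 - Y₄) - Y₄ ^ 2) + (2 * (exp Y₂ - 1 - Y₂) - Y₂ ^ 2) * Y₄) + 6 * ((exp Y₂ - 1 - Y₂) * (exp Y₄ - 1 - Y₄)))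
        + (3 * (Y₃ * (2 * (exp Y₄ - 1 - Y₄) - Y₄ ^ 2) + (2 * (exp Y₃ - 1 - Y₃) - Y₃ ^ 2) * Y₄) + 6 * ((exp Y₃ - 1 - Y₃) * (exp Y₄ - 1 - Y₄)))‖
        ≤ 6 * (145 / 24 * m ^ 4) := by
    have p12 := pair_piece_le hm0 h1 h2 hw1 hw2 hv1 hv2
    have p13 := pair_piece_le hm0 h1 h3 hw1 hw3 hv1 hv3
    have p14 := pair_piece_le hm0 h1 h4 hw1 hw4 hv1 hv4
    have p23 := pair_piece_le hm0 h2 h3 hw2 hw3 hv2 hv3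
    have p24 := pair_piece_le hm0 h2 h4 hw2 hw4 hv2 hv4
    have p34 := pair_piece_le hm0 h3 h4 hw3 hw4 hv3 hv4
    exact ((norm_add_le _ _).trans (add_le_add ((norm_add_le _ _).trans (add_le_add ((norm_add_le _ _).trans (add_le_add
      ((norm_add_le _ _).trans (add_le_add ((norm_add_le _ _).trans (add_le_add p12 p13)) p14)) p23)) p24)) p34)).trans (by linarith)
  have hT : ‖6 * ((exp Y₁ - 1 - Y₁) * (exp Y₂ - 1) * (exp Y₃ - 1) + Y₁ * (exp Y₂ - 1 - Y₂) * (exp Y₃ - 1) + Y₁ * Y₂ * (exp Y₃ - 1 - Y₃))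
        + 6 * ((exp Y₁ - 1 - Y₁) * (exp Y₂ - 1) * (exp Y₄ - 1) + Y₁ * (exp Y₂ - 1 - Y₂) * (exp Y₄ - 1) + Y₁ * Y₂ * (exp Y₄ - 1 - Y₄))
        + 6 * ((exp Y₁ - 1 - Y₁) * (exp Y₃ - 1) * (exp Y₄ - 1) + Y₁ * (exp Y₃ - 1 - Y₃) * (exp Y₄ - 1) + Y₁ * Y₃ * (exp Y₄ - 1 - Y₄))
        + 6 * ((exp Y₂ - 1 - Y₂) * (exp Y₃ - 1) * (exp Y₄ - 1) + Y₂ * (exp Y₃ - 1 - Y₃) * (exp Y₄ - 1) + Y₂ * Y₃ * (exp Y₄ - 1 - Y₄))‖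
        ≤ 4 * (63 / 2 * m ^ 4) := by
    have t123 := triple_piece_le hm0 h1 h2 hv1 hv2 hv3 hu2 hu3
    have t124 := triple_piece_le hm0 h1 h2 hv1 hv2 hv4 hu2 hu4
    have t134 := triple_piece_le hm0 h1 h3 hv1 hv3 hv4 hu3 hu4
    have t234 := triple_piece_le hm0 h2 h3 hv2 hv3 hv4 hu3 hu4
    exact ((norm_add_le _ _).trans (add_le_add ((norm_add_le _ _).trans (add_le_add ((norm_add_le _ _).trans
      (add_le_add t123 t124)) t134)) t234)).trans (by linarith)
  have hQ := quad_piece_le hm0 hu1 hu2 hu3 hu4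
  have h7 := ((norm_add_le _ _).trans (add_le_add ((norm_add_le _ _).trans (add_le_add ((norm_add_le _ _).trans
      (add_le_add hS hP)) hT)) hQ))
  rw [← key, norm_smul, Complex.norm_ofNat] at h7
  refine le_of_mul_le_mul_left (h7.trans ?_) (by norm_num : (0 : ℝ) < 6)
  have hm4 : 0 ≤ m ^ 4 := by positivity
  linarith

end Product

end Summit.QuantumFields.YangMills.Theorems.FlatPlaqCubic

end
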